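import Literature.Probability.RandomPlanarGeometry.SLEKappaRhoAssemblyProofs
import Literature.Probability.RandomPlanarGeometry.SLERealFlowIto
import Literature.Analysis.FunctionSpaces.BesselBoundaryEntranceProofs
import Literature.Analysis.FunctionSpaces.BesselBoundaryZeroSetProofs
import Literature.Analysis.FunctionSpaces.BesselHittingZero
import HarnessLib

/-!
# [LSW] Lemma 8.3 (2)–(3) discharged: the real points swallowed by SLE(κ, ρ), `κ ≤ 4`

Proof-only complement to `SLEKappaRho` (no definition, no named fact): the named fact
`Literature.Probability.RandomPlanarGeometry.SLEKappaRho.swallowingTime_ofReal` of that file,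

* G. F. Lawler, O. Schramm, W. Werner, *Conformal restriction: the chordal case*, J. Amer. Math.
  Soc. **16** (2003) 917–955, arXiv:math/0209343 (**[LSW]**), Lemma 8.3 (2)–(3) (p. 36): "Let
  `κ > 0`, `ρ > −2` and set `ρ₀ := −2 + κ/2`. […] (2) If `κ ≤ 4` and `ρ ≥ ρ₀`, then a.s.
  `K_∞ ∩ ℝ = {0}`. (3) If `κ ≤ 4` and `ρ < ρ₀`, then a.s. `K_∞ ∩ ℝ = (−∞, 0]`",

read through the swallowing times of real points, is PROVED here
(`SLEKappaRho.swallowingTime_ofReal_holds`). Its positive-axis clause is the tree's theorem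
`SLEKappaRho.swallowingTime_ofReal_pos_holds` (`SLEKappaRhoAssemblyProofs`); this file supplies
the two negative-axis clauses, following the printed proof (p. 36):

"Now suppose `ρ ≥ ρ₀`. Then the Bessel process `Z_t/√κ` has dimension `d ≥ 2` […]
Consequently, a.s. `W_t − O_t = Z_t > 0` for all `t > 0`. If `x < 0`, then `g_t(x) ≤ O_t` for
all `t ≥ 0`. Hence, `K_∞ ∩ (−∞, 0) = ∅` a.s. Now take `ρ ∈ (−2, ρ₀)`. Set `y_t = g_t(−1)` […]
Using `W_t − y_t ≥ W_t − O_t` and `ρ < 0`, we get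
`W_t − y_t = √κ B_t + ∫₀ᵗ (ρ/(W_s − O_s) + 2/(W_s − y_s)) ds ≤ √κ B_t + ∫₀ᵗ (ρ + 2) ds/(W_s − y_s)`.
So that `W_t − y_t` is smaller than a Bessel process that hits zero a.s. Hence, a.s.
`−1 ∈ K_∞` […] and by scaling `(−∞, 0] ⊂ K_∞` a.s."

The stochastic inputs are theorems of the tree, on the canonical space of the construction
(`IsSLEKappaRhoPair`: `Z = W − O = √κ X`, `X = BES^d(0)`, `d = 1 + 2(ρ + 2)/κ`, driven by the
canonical Brownian motion `B`): "the `d`-dimensional Bessel process returns to zero iff `d < 2`"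
as `IsBesselProcess.ae_forall_pos_of_two_le_zero_holds` (`d ≥ 2`, started at `0`: `X_t > 0` for
all `t > 0`) and `IsBesselProcess.ae_exists_eq_zero_of_lt_two` (`1 < d < 2`, started at
`x₀ > 0`: `X` vanishes somewhere), the Bessel stochastic differential equation
`IsBesselProcess.ae_eq_add_brownian_add_integral_holds`, the Lebesgue-null zero set
`IsBesselProcess.ae_pos_of_ae_restrict_Ioi_holds` (files
`Literature/Analysis/FunctionSpaces/BesselBoundary*.lean`, `BesselHittingZero.lean`), and for
the driving pair `W_t = √κ B_t + ρ ∫₀ᵗ du/Z_u` with `∫₀ᵗ du/Z_u < ∞` and continuous paths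
(`SLEKappaRho.integral_inv_eq_holds`, `SLEKappaRho.ae_snd_eq_of`,
`IsSLEKappaRhoPair.ae_continuous`). What is proved here is the deterministic, path-by-path part:

* `Loewner.sub_pos_of_gap_identity` — **"`g_t(x) ≤ O_t`"** as a window lemma: if
  `U − z = −x + 2 ∫ (1/U − 1/z)` starts positive and `z > 0` wherever `U = z`, then `U − z`
  never vanishes (at a first zero `t⋆`, `z ≥ c > 0` on `[t⋆ − η, t⋆]` and
  `1/U − 1/z = −(U − z)/(Uz) ≥ −(U − z)/c²`, an elementary Grönwall contradiction);
* `Loewner.neg_realFlow_sub_eq_of_neg` — the gap `U = W − re g(x)` of a negative point in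
  integrated form, `U − Z = −x + 2 ∫₀ᵗ (1/U − 1/Z)` (`Loewner.realFlow_eq_sub_add_integral`);
* `Loewner.swallowingTime_eq_top_of_neg_of_forall_pos` — clause (2) pathwise: if `Z > 0` on
  `(0, ∞)` then `T_x = ⊤` for `x < 0` (were `T_x = b < ∞`, the frozen gap would vanish at `b`,
  `Loewner.continuous_realFlowStop_of_lt`, while `U − Z ≥ 0` and `Z_b > 0`);
* `Loewner.swallowingTime_lt_top_of_bessel_comparison` — clause (3) pathwise: with
  `ρ < 0 < ρ + 2` and a comparison path `v_t = −x + √κ B_t + (ρ + 2) ∫₀ᵗ du/v_u` vanishing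
  somewhere, `T_x < ⊤` (were `x` never swallowed, `U ≥ Z` and the Volterra comparison
  `(v − U)_t = (ρ + 2) ∫ (1/v − 1/U) + ρ ∫ (1/U − 1/Z)` after the last time `v − U ≥ 0` before
  the first zero of `v` would force `v − U > 0` where it is negative);
* `SLEKappaRho.swallowingTime_ofReal_holds` — the assembly (clause (3) for the levels
  `x = −(n + 1)` with `v = √κ · BES^d((n + 1)/√κ)`, then all `x < 0` by
  `Loewner.swallowingTime_mono_left`, [LSW]'s "by scaling").

## References

* G. F. Lawler, O. Schramm, W. Werner, *Conformal restriction: the chordal case*, J. Amer. Math.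
  Soc. 16 (2003), 917–955, §8.3, Lemma 8.3 and its proof (arXiv math/0209343, p. 36).
* D. Revuz, M. Yor, *Continuous Martingales and Brownian Motion* (3rd ed., 1999), Ch. XI §1.
* G. F. Lawler, *Conformally Invariant Processes in the Plane*, AMS (2005), §4.1 (real points,
  `T_x`), §1.10 (Bessel processes).
-/

noncomputable section

open MeasureTheory Filter Set Topology
open scoped NNReal ENNReal

namespace Literature.Probability.RandomPlanarGeometry

namespace Loewner

/-! ### A window lemma: the gap above `Z` cannot close -/

/-- **The gap above `Z` stays positive (window lemma).** Let `U`, `z` be continuous real paths on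
`ℝ≥0` with `U_0 − z_0 = −x > 0`, `u ↦ 1/U_u`, `u ↦ 1/z_u` integrable on `[0, b]`, and
`U_t − z_t = −x + 2 ∫₀ᵗ (1/U_u − 1/z_u) du` for `t ≤ b`; assume `z_t > 0` at every time
`0 < t ≤ b` at which `U_t = z_t`. Then `U_t − z_t > 0` for all `t ≤ b`. (At the first zero `t⋆`
of `h = U − z` one has `z ≥ c > 0` on a window `[t⋆ − η, t⋆]`, where `h ≥ 0` and hence
`1/U − 1/z = −h/(Uz) ≥ −h/c²`; with `M = max h` on the window, `0 = h(t⋆) ≥ M(1 − 2η/c²) > 0`.)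
For an SLE(κ, ρ) sample path and `x < 0` alive, `U = W − g(x)`, `z = Z = W − O`, and the lemma is
[LSW]'s "if `x < 0`, then `g_t(x) ≤ O_t`" (p. 36). [cite: LawlerSchrammWerner2003Restriction, proof of Lemma 8.3 (p. 36)] -/
theorem sub_pos_of_gap_identity {U z : ℝ≥0 → ℝ} {b : ℝ≥0} {x : ℝ} (hx : x < 0)
    (hUc : Continuous U) (hz : Continuous z) (h0 : U 0 - z 0 = -x)
    (hzU : ∀ t, 0 < t → t ≤ b → U t = z t → 0 < z t)
    (hUint : IntervalIntegrable (fun u : ℝ ↦ (U u.toNNReal)⁻¹) volume 0 b)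
    (hzint : IntervalIntegrable (fun u : ℝ ↦ (z u.toNNReal)⁻¹) volume 0 b)
    (hident : ∀ t : ℝ≥0, t ≤ b →
      U t - z t = -x + 2 * ∫ u in (0:ℝ)..(t:ℝ), ((U u.toNNReal)⁻¹ - (z u.toNNReal)⁻¹)) :
    ∀ t, t ≤ b → 0 < U t - z t := by
  set h : ℝ≥0 → ℝ := fun t ↦ U t - z t with hh
  have hhc : Continuous h := hUc.sub hz
  have hh0 : h 0 = -x := h0
  set f : ℝ → ℝ := fun u ↦ (U u.toNNReal)⁻¹ - (z u.toNNReal)⁻¹ with hf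
  have hfint : ∀ s t : ℝ≥0, s ≤ b → t ≤ b → IntervalIntegrable f volume s t := by
    intro s t hs ht
    refine (hUint.sub hzint).mono_set ?_
    rw [uIcc_of_le b.coe_nonneg]
    exact uIcc_subset_Icc ⟨s.coe_nonneg, by exact_mod_cast hs⟩ ⟨t.coe_nonneg, by exact_mod_cast ht⟩
  by_contra hneg
  push Not at hneg
  obtain ⟨t₁, ht₁b, ht₁⟩ := hneg
  -- the first time `ts ≤ b` with `h ≤ 0`
  set S : Set ℝ≥0 := {t | t ≤ b ∧ h t ≤ 0} with hS
  have hSc : IsClosed S :=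
    (isClosed_le continuous_id continuous_const).inter (isClosed_le hhc continuous_const)
  have ht₁S : t₁ ∈ S := ⟨ht₁b, ht₁⟩
  have hSbdd : BddBelow S := OrderBot.bddBelow S
  set ts := sInf S with hts
  have htsS : ts ∈ S := hSc.csInf_mem ⟨t₁, ht₁S⟩ hSbdd
  have hts_le_b : ts ≤ b := htsS.1
  have hpos_before : ∀ t, t < ts → 0 < h t := by
    intro t ht
    have hnot : t ∉ S := notMem_of_lt_csInf ht hSbdd
    by_contra hle
    exact hnot ⟨ht.le.trans hts_le_b, not_lt.1 hle⟩
  have hts0 : 0 < ts := by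
    rcases eq_zero_or_pos ts with h0' | h0'
    · exfalso
      have := htsS.2
      rw [h0', hh0] at this
      linarith
    · exact h0'
  have hhts : h ts = 0 := by
    refine le_antisymm htsS.2 ?_
    have hcl : IsClosed {t : ℝ≥0 | 0 ≤ h t} := isClosed_le continuous_const hhc
    have hsub : Iio ts ⊆ {t : ℝ≥0 | 0 ≤ h t} := fun t ht ↦ (hpos_before t ht).le
    have hcl' : closure (Iio ts) ⊆ {t : ℝ≥0 | 0 ≤ h t} := closure_minimal hsub hcl
    have hne : (Iio ts).Nonempty := ⟨0, hts0⟩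
    rw [closure_Iio' hne] at hcl'
    exact hcl' (le_refl ts)
  -- `z ts > 0` and the window `[ts − η, ts]` on which `z > c := z ts / 2`
  have hzts : 0 < z ts := hzU ts hts0 hts_le_b (sub_eq_zero.1 hhts)
  set c : ℝ := z ts / 2 with hc
  have hc0 : 0 < c := by positivity
  obtain ⟨η₀, hη₀, hzwin⟩ : ∃ η₀ > (0:ℝ), ∀ s : ℝ≥0, dist s ts < η₀ → c < z s := by
    obtain ⟨δ, hδ, hδ'⟩ := Metric.continuousAt_iff.1 (hz.continuousAt (x := ts)) c hc0
    refine ⟨δ, hδ, fun s hs ↦ ?_⟩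
    have := hδ' hs
    rw [Real.dist_eq, abs_lt] at this
    simp only [hc] at this ⊢
    linarith
  obtain ⟨η, hη0, hηts, hηη₀, hηc⟩ :
      ∃ η : ℝ≥0, 0 < η ∧ η ≤ ts ∧ (η : ℝ) < η₀ ∧ (η : ℝ) < c ^ 2 / 2 := by
    have hm : 0 < min (ts : ℝ) (min (η₀ / 2) (c ^ 2 / 4)) := by positivity
    refine ⟨⟨min (ts : ℝ) (min (η₀ / 2) (c ^ 2 / 4)), hm.le⟩, ?_, ?_, ?_, ?_⟩
    · exact_mod_cast hm
    · rw [← NNReal.coe_le_coe]; exact min_le_left _ _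
    · show min (ts : ℝ) (min (η₀ / 2) (c ^ 2 / 4)) < η₀
      have := min_le_right (ts : ℝ) (min (η₀ / 2) (c ^ 2 / 4))
      have := min_le_left (η₀ / 2) (c ^ 2 / 4)
      linarith
    · show min (ts : ℝ) (min (η₀ / 2) (c ^ 2 / 4)) < c ^ 2 / 2
      have := min_le_right (ts : ℝ) (min (η₀ / 2) (c ^ 2 / 4))
      have := min_le_right (η₀ / 2) (c ^ 2 / 4)
      have : 0 < c ^ 2 := by positivity
      linarith
  set a : ℝ≥0 := ts - η with ha
  have ha_coe : (a : ℝ) = ts - η := NNReal.coe_sub hηts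
  have ha_le : a ≤ ts := tsub_le_self
  have ha_lt : a < ts := by
    rw [← NNReal.coe_lt_coe, ha_coe]; have : (0:ℝ) < η := hη0; linarith
  have hwin_z : ∀ s : ℝ≥0, a ≤ s → s ≤ ts → c < z s := by
    intro s h1 h2
    apply hzwin
    have h2' : (s : ℝ) ≤ ts := by exact_mod_cast h2
    have h1' : (ts : ℝ) - η ≤ s := by rw [← ha_coe]; exact_mod_cast h1
    rw [NNReal.dist_eq, abs_sub_comm, abs_of_nonneg (sub_nonneg.2 h2')]
    linarith
  have hwin_h : ∀ s : ℝ≥0, s ≤ ts → 0 ≤ h s := by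
    intro s h2
    rcases eq_or_lt_of_le h2 with heq | hlt
    · rw [heq, hhts]
    · exact (hpos_before s hlt).le
  -- the maximum `M > 0` of `h` on the window
  obtain ⟨s₀, hs₀, hmax⟩ := isCompact_Icc.exists_isMaxOn (nonempty_Icc.2 ha_le) hhc.continuousOn
  set M := h s₀ with hM
  have hMpos : 0 < M := lt_of_lt_of_le (hpos_before a ha_lt) (hmax ⟨le_rfl, ha_le⟩)
  have hs₀ts : s₀ ≤ ts := hs₀.2
  have hs₀b : s₀ ≤ b := hs₀ts.trans hts_le_b
  -- lower bound for the integrand on `[s₀, ts]`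
  have hf_ge : ∀ u ∈ Icc (s₀ : ℝ) ts, -(M / c ^ 2) ≤ f u := by
    intro u hu
    have hu0 : 0 ≤ u := s₀.coe_nonneg.trans hu.1
    have hus : s₀ ≤ u.toNNReal := by
      rw [← NNReal.coe_le_coe, Real.coe_toNNReal _ hu0]; exact hu.1
    have hut : u.toNNReal ≤ ts := by
      rw [← NNReal.coe_le_coe, Real.coe_toNNReal _ hu0]; exact hu.2
    have hau : a ≤ u.toNNReal := hs₀.1.trans hus
    have hzu : c < z u.toNNReal := hwin_z _ hau hut
    have hhu : 0 ≤ h u.toNNReal := hwin_h _ hut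
    have hhuM : h u.toNNReal ≤ M := hmax ⟨hau, hut⟩
    have hUu : U u.toNNReal = z u.toNNReal + h u.toNNReal := by simp only [hh]; ring
    have hUpos' : c < U u.toNNReal := by rw [hUu]; linarith
    have hUpos'' : 0 < U u.toNNReal := hc0.trans hUpos'
    have hzpos' : 0 < z u.toNNReal := hc0.trans hzu
    have hprod : c ^ 2 ≤ U u.toNNReal * z u.toNNReal := by
      rw [sq]; exact mul_le_mul hUpos'.le hzu.le hc0.le hUpos''.le
    have hfu : f u = -(h u.toNNReal / (U u.toNNReal * z u.toNNReal)) := by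
      simp only [hf, hUu]
      field_simp
      ring
    rw [hfu, neg_le_neg_iff]
    calc h u.toNNReal / (U u.toNNReal * z u.toNNReal)
        ≤ h u.toNNReal / c ^ 2 := div_le_div_of_nonneg_left hhu (by positivity) hprod
      _ ≤ M / c ^ 2 := div_le_div_of_nonneg_right hhuM (by positivity)
  -- `h ts − h s₀ = 2 ∫_{s₀}^{ts} f ≥ −2 (M/c²) η`
  have hfint' : IntervalIntegrable f volume s₀ ts := hfint s₀ ts hs₀b hts_le_b
  have hdiff : h ts - h s₀ = 2 * ∫ u in (s₀:ℝ)..(ts:ℝ), f u := by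
    have h1 : h ts = -x + 2 * ∫ u in (0:ℝ)..(ts:ℝ), f u := hident ts hts_le_b
    have h2 : h s₀ = -x + 2 * ∫ u in (0:ℝ)..(s₀:ℝ), f u := hident s₀ hs₀b
    have hfint0 : IntervalIntegrable f volume (0:ℝ) s₀ := by
      simpa using hfint 0 s₀ bot_le hs₀b
    rw [h1, h2, ← intervalIntegral.integral_add_adjacent_intervals hfint0 hfint']
    ring
  have hint_ge : -(M / c ^ 2) * ((ts : ℝ) - s₀) ≤ ∫ u in (s₀:ℝ)..(ts:ℝ), f u := by
    have hle : (s₀ : ℝ) ≤ ts := by exact_mod_cast hs₀ts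
    have := intervalIntegral.integral_mono_on hle intervalIntegrable_const hfint' hf_ge
    rwa [intervalIntegral.integral_const, smul_eq_mul, mul_comm] at this
  have hlen : (ts : ℝ) - s₀ ≤ η := by
    have h1 : (ts : ℝ) - η ≤ s₀ := by rw [← ha_coe]; exact_mod_cast hs₀.1
    linarith
  have hkey : M * (1 - 2 * η / c ^ 2) ≤ h ts := by
    have h1 : h ts = M + 2 * ∫ u in (s₀:ℝ)..(ts:ℝ), f u := by rw [← hdiff, hM]; ring
    rw [h1]
    have h2 : -(M / c ^ 2) * (η : ℝ) ≤ -(M / c ^ 2) * ((ts : ℝ) - s₀) :=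
      mul_le_mul_of_nonpos_left hlen (by
        have : 0 ≤ M / c ^ 2 := by positivity
        linarith)
    have h3 : M * (1 - 2 * η / c ^ 2) = M + 2 * (-(M / c ^ 2) * η) := by
      field_simp
      ring
    rw [h3]
    linarith
  have hfac : 0 < 1 - 2 * (η : ℝ) / c ^ 2 := by
    have hc2 : 0 < c ^ 2 := by positivity
    rw [sub_pos, div_lt_one hc2]
    linarith
  have : 0 < h ts := lt_of_lt_of_le (mul_pos hMpos hfac) hkey
  rw [hhts] at this
  exact lt_irrefl _ this

/-! ### The gap of a negative point in integrated form -/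

/-- **The gap `U = W − g(x)` of a negative point and its excess over `Z`, in integrated form.**
For a continuous driving function `w = z + o` with `w 0 = 0`, `o_t = −2 ∫₀ᵗ du/z_u` (locally
integrable inverse) and `x < 0` alive at time `t`, the gap `U_s = w_s − re g_s(x) = −realFlow w x s`
is positive on `[0, t]`, `u ↦ 1/U_u` is integrable on `[0, t]`, and
`U_t − z_t = −x + 2 ∫₀ᵗ (1/U_u − 1/z_u) du` (the real flow in integrated form,
`realFlow_eq_sub_add_integral`). [cite: LawlerSchrammWerner2003Restriction, proof of Lemma 8.3 (p. 36)] -/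
theorem neg_realFlow_sub_eq_of_neg {w z o : ℝ≥0 → ℝ} (hw : Continuous w) (hw0 : w 0 = 0)
    (hint : ∀ t : ℝ≥0, IntervalIntegrable (fun u : ℝ ↦ (z u.toNNReal)⁻¹) volume 0 t)
    (ho : ∀ t : ℝ≥0, o t = -2 * ∫ u in (0:ℝ)..(t:ℝ), (z u.toNNReal)⁻¹)
    (hwzo : ∀ t, w t = z t + o t) {x : ℝ} (hx : x < 0) {t : ℝ≥0}
    (ht : (t : WithTop ℝ≥0) < swallowingTime w x) :
    IntervalIntegrable (fun u : ℝ ↦ (-realFlow w x u.toNNReal)⁻¹) volume 0 t ∧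
      -realFlow w x t - z t =
        -x + 2 * ∫ u in (0:ℝ)..(t:ℝ), ((-realFlow w x u.toNNReal)⁻¹ - (z u.toNNReal)⁻¹) := by
  have hxw : x < w 0 := by rwa [hw0]
  have hxw' : x ≠ w 0 := hxw.ne
  have halive : ∀ u ∈ Icc (0:ℝ) t, (u.toNNReal : WithTop ℝ≥0) < swallowingTime w x := by
    intro u hu
    refine lt_of_le_of_lt ?_ ht
    have : u.toNNReal ≤ t := by
      rw [← NNReal.coe_le_coe, Real.coe_toNNReal _ hu.1]; exact hu.2
    exact_mod_cast this
  have hUcont : ContinuousOn (fun u : ℝ ↦ (-realFlow w x u.toNNReal)⁻¹) (Icc 0 t) := by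
    have h1 : ContinuousOn (fun u : ℝ ↦ -realFlowStop w x u.toNNReal) (Icc 0 t) :=
      ((continuous_realFlowStop_of_lt hw hxw).comp continuous_real_toNNReal).continuousOn.neg
    have h2 : ContinuousOn (fun u : ℝ ↦ -realFlow w x u.toNNReal) (Icc 0 t) := by
      refine h1.congr fun u hu ↦ ?_
      simp only [realFlowStop_of_lt (halive u hu)]
    refine h2.inv₀ fun u hu ↦ ?_
    exact (neg_pos.2 (realFlow_neg hw hxw (halive u hu))).ne'
  have hUint : IntervalIntegrable (fun u : ℝ ↦ (-realFlow w x u.toNNReal)⁻¹) volume 0 t :=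
    hUcont.intervalIntegrable_of_Icc t.coe_nonneg
  refine ⟨hUint, ?_⟩
  have h1 := realFlow_eq_sub_add_integral hw hxw' ht
  have h2 : ∫ u in (0:ℝ)..(t:ℝ), 2 / realFlow w x u.toNNReal =
      -2 * ∫ u in (0:ℝ)..(t:ℝ), (-realFlow w x u.toNNReal)⁻¹ := by
    rw [← intervalIntegral.integral_const_mul]
    refine intervalIntegral.integral_congr fun u _ ↦ ?_
    simp only [inv_neg, div_eq_mul_inv]
    ring
  have h3 : (∫ u in (0:ℝ)..(t:ℝ), ((-realFlow w x u.toNNReal)⁻¹ - (z u.toNNReal)⁻¹)) =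
      (∫ u in (0:ℝ)..(t:ℝ), (-realFlow w x u.toNNReal)⁻¹) - ∫ u in (0:ℝ)..(t:ℝ), (z u.toNNReal)⁻¹ :=
    intervalIntegral.integral_sub hUint (hint t)
  rw [h1, h2, hwzo t, ho t, h3]
  ring

/-! ### [LSW] Lemma 8.3 (2) on the negative axis, pathwise -/

/-- **Core of [LSW] Lemma 8.3 (2) on the negative axis, pathwise.** Let `w = z + o` be a
continuous driving function with `w 0 = 0`, where `z` is continuous, positive on `(0, ∞)`, with
locally integrable inverse, and `o_t = −2 ∫₀ᵗ du/z_u` (an SLE(κ, ρ) sample path with `ρ ≥ ρ₀`: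
`z = Z = W − O > 0` on `(0, ∞)` as the Bessel dimension is `≥ 2`). Then no `x < 0` is swallowed:
`T_x = ⊤`. ([LSW] p. 36: "a.s. `W_t − O_t = Z_t > 0` for all `t > 0`. If `x < 0`, then
`g_t(x) ≤ O_t` for all `t ≥ 0`. Hence, `K_∞ ∩ (−∞, 0) = ∅` a.s.": if `T_x = b < ∞` the gap
`U = W − g(x)` vanishes at `b` while `U − Z = O − g(x) ≥ 0` (`sub_pos_of_gap_identity`) and
`Z_b > 0`.) [cite: LawlerSchrammWerner2003Restriction, proof of Lemma 8.3 (p. 36)] -/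
theorem swallowingTime_eq_top_of_neg_of_forall_pos {w z o : ℝ≥0 → ℝ} (hw : Continuous w)
    (hw0 : w 0 = 0) (hz : Continuous z) (hzpos : ∀ t, 0 < t → 0 < z t)
    (hint : ∀ t : ℝ≥0, IntervalIntegrable (fun u : ℝ ↦ (z u.toNNReal)⁻¹) volume 0 t)
    (ho : ∀ t : ℝ≥0, o t = -2 * ∫ u in (0:ℝ)..(t:ℝ), (z u.toNNReal)⁻¹)
    (hwzo : ∀ t, w t = z t + o t) {x : ℝ} (hx : x < 0) :
    swallowingTime w x = ⊤ := by
  by_contra hT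
  obtain ⟨b, hb⟩ := WithTop.ne_top_iff_exists.1 hT
  have hxw : x < w 0 := by rwa [hw0]
  have hxw' : x ≠ w 0 := hxw.ne
  have hxc : (x : ℂ) ≠ w 0 := fun h ↦ hxw' (by exact_mod_cast h)
  have hb0 : 0 < b := by
    have := swallowingTime_pos_holds hw hxc
    rw [← hb] at this
    exact_mod_cast this
  have hltb : ∀ {t : ℝ≥0}, t < b → (t : WithTop ℝ≥0) < swallowingTime w x := fun ht ↦ by
    rw [← hb]; exact_mod_cast ht
  -- the frozen gap `U`, continuous, `U b = 0`
  set U : ℝ≥0 → ℝ := fun t ↦ -realFlowStop w x t with hU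
  have hUc : Continuous U := (continuous_realFlowStop_of_lt hw hxw).neg
  have hUb : U b = 0 := by simp only [hU, realFlowStop_of_le hb.ge, neg_zero]
  have hUeq : ∀ t : ℝ≥0, t < b → U t = -realFlow w x t := fun t ht ↦ by
    simp only [hU, realFlowStop_of_lt (hltb ht)]
  have hz0 : z 0 = 0 := by
    have h1 := hwzo 0
    rw [hw0, ho 0] at h1
    simp only [NNReal.coe_zero, intervalIntegral.integral_same, mul_zero, add_zero] at h1
    exact h1.symm
  -- `h = U − z` is `< 0` at `b`, hence at some `b' < b`
  have hhc : Continuous fun t ↦ U t - z t := hUc.sub hz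
  have hhb : U b - z b < 0 := by rw [hUb, zero_sub, neg_lt_zero]; exact hzpos b hb0
  obtain ⟨b', hb'b, hb'neg⟩ : ∃ b' : ℝ≥0, b' < b ∧ U b' - z b' < 0 := by
    have hev : ∀ᶠ t in 𝓝 b, U t - z t < 0 := (hhc.tendsto b).eventually (gt_mem_nhds hhb)
    haveI : (𝓝[<] b).NeBot := nhdsLT_neBot_of_exists_lt ⟨0, hb0⟩
    have hev' : ∀ᶠ t in 𝓝[<] b, U t - z t < 0 := hev.filter_mono nhdsWithin_le_nhds
    obtain ⟨b', h1, h2⟩ := (hev'.and self_mem_nhdsWithin).exists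
    exact ⟨b', h2, h1⟩
  -- but the window lemma on `[0, b']` says `U − z > 0` there
  have hU0 : U 0 - z 0 = -x := by
    rw [hUeq 0 hb0, realFlow_zero hw hxw', hw0, hz0]; ring
  have key := neg_realFlow_sub_eq_of_neg hw hw0 hint ho hwzo hx (hltb hb'b)
  have hUint : IntervalIntegrable (fun u : ℝ ↦ (U u.toNNReal)⁻¹) volume 0 b' := by
    refine key.1.congr fun u hu ↦ ?_
    rw [uIoc_of_le b'.coe_nonneg] at hu
    have hub : u.toNNReal < b := by
      refine lt_of_le_of_lt ?_ hb'b
      rw [← NNReal.coe_le_coe, Real.coe_toNNReal _ hu.1.le]; exact hu.2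
    simp only [hUeq _ hub]
  have hident : ∀ t : ℝ≥0, t ≤ b' →
      U t - z t = -x + 2 * ∫ u in (0:ℝ)..(t:ℝ), ((U u.toNNReal)⁻¹ - (z u.toNNReal)⁻¹) := by
    intro t ht
    have htb : t < b := lt_of_le_of_lt ht hb'b
    have k := (neg_realFlow_sub_eq_of_neg hw hw0 hint ho hwzo hx (hltb htb)).2
    rw [hUeq t htb, k]
    congr 2
    refine intervalIntegral.integral_congr fun u hu ↦ ?_
    rw [uIcc_of_le t.coe_nonneg] at hu
    have hub : u.toNNReal < b := lt_of_le_of_lt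
      (by rw [← NNReal.coe_le_coe, Real.coe_toNNReal _ hu.1]; exact hu.2) htb
    simp only [hUeq _ hub]
  have hzU : ∀ t, 0 < t → t ≤ b' → U t = z t → 0 < z t := fun t ht _ _ ↦ hzpos t ht
  have := sub_pos_of_gap_identity hx hUc hz hU0 hzU hUint (hint b') hident b' le_rfl
  linarith


/-! ### [LSW] Lemma 8.3 (3) on the negative axis, pathwise -/

/-- **Core of [LSW] Lemma 8.3 (3), pathwise: a negative point is swallowed in finite time when the
comparison Bessel path hits zero.** Let `w = z + o` be a continuous driving function with
`w 0 = 0`, `z ≥ 0` continuous and positive at Lebesgue-a.e. positive time, `u ↦ 1/z_u` locally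
integrable, `o_t = −2 ∫₀ᵗ du/z_u`, and `w_t = √κ β_t + ρ ∫₀ᵗ du/z_u` with `ρ < 0 < ρ + 2` (an
SLE(κ, ρ) sample path, `κ ≤ 4`, `−2 < ρ < ρ₀`: `z = Z`, `β = B`). Let `x < 0` and let `v` be a
continuous path with `v_0 = −x`, `u ↦ 1/v_u` locally integrable,
`v_t = −x + √κ β_t + (ρ + 2) ∫₀ᵗ du/v_u`, vanishing somewhere (`v = √κ` times a Bessel process of
dimension `d = 1 + 2(ρ + 2)/κ < 2` from `−x/√κ`, driven by `B`). Then `T_x < ⊤`. [LSW] p. 36: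
"Using `W_t − y_t ≥ W_t − O_t` and `ρ < 0`, we get
`W_t − y_t = √κ B_t + ∫₀ᵗ (ρ/(W_s − O_s) + 2/(W_s − y_s)) ds ≤ √κ B_t + ∫₀ᵗ (ρ + 2) ds/(W_s − y_s)`.
So that `W_t − y_t` is smaller than a Bessel process that hits zero a.s. Hence, a.s.
`−1 ∈ K_∞`." Made pathwise: if `x` were never swallowed, `U = w − re g(x) > 0` would satisfy
`U ≥ z` (`sub_pos_of_gap_identity`) and `U_t = −x + w_t + 2 ∫₀ᵗ du/U_u`; at the last time
`t⋆ < σ` (`σ` the first zero of `v`) with `v − U ≥ 0` one gets, for `t⋆ < t < σ`,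
`(v − U)_t = (ρ + 2) ∫_{t⋆}^t (1/v − 1/U) + ρ ∫_{t⋆}^t (1/U − 1/z) > 0`, a contradiction.
[cite: LawlerSchrammWerner2003Restriction, proof of Lemma 8.3 (p. 36)] -/
theorem swallowingTime_lt_top_of_bessel_comparison {w z o β v : ℝ≥0 → ℝ} (hw : Continuous w)
    (hw0 : w 0 = 0) (hz : Continuous z)
    (hzae : ∀ᵐ s ∂(volume.restrict (Ioi (0:ℝ))), 0 < z s.toNNReal)
    (hint : ∀ t : ℝ≥0, IntervalIntegrable (fun u : ℝ ↦ (z u.toNNReal)⁻¹) volume 0 t)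
    (ho : ∀ t : ℝ≥0, o t = -2 * ∫ u in (0:ℝ)..(t:ℝ), (z u.toNNReal)⁻¹)
    (hwzo : ∀ t, w t = z t + o t) {κ ρ : ℝ} (hρ : ρ < 0) (hρ2 : 0 < ρ + 2)
    (hweq : ∀ t : ℝ≥0, w t = Real.sqrt κ * β t + ρ * ∫ u in (0:ℝ)..(t:ℝ), (z u.toNNReal)⁻¹)
    {x : ℝ} (hx : x < 0) (hv : Continuous v) (hv0 : v 0 = -x)
    (hvint : ∀ t : ℝ≥0, IntervalIntegrable (fun u : ℝ ↦ (v u.toNNReal)⁻¹) volume 0 t)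
    (hveq : ∀ t : ℝ≥0, v t = -x + Real.sqrt κ * β t +
      (ρ + 2) * ∫ u in (0:ℝ)..(t:ℝ), (v u.toNNReal)⁻¹)
    (hvzero : ∃ t, v t = 0) :
    swallowingTime w x < ⊤ := by
  rw [lt_top_iff_ne_top]
  intro hT
  have hxw : x < w 0 := by rwa [hw0]
  have hxw' : x ≠ w 0 := hxw.ne
  have halive : ∀ t : ℝ≥0, (t : WithTop ℝ≥0) < swallowingTime w x := fun t ↦ by
    rw [hT]; exact WithTop.coe_lt_top t
  -- sub-interval integrability
  have hmono : ∀ {F : ℝ → ℝ}, (∀ t : ℝ≥0, IntervalIntegrable F volume 0 t) →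
      ∀ s t : ℝ≥0, s ≤ t → IntervalIntegrable F volume s t := by
    intro F hF s t hst
    refine (hF t).mono_set ?_
    rw [uIcc_of_le t.coe_nonneg]
    exact uIcc_subset_Icc ⟨s.coe_nonneg, by exact_mod_cast hst⟩ ⟨t.coe_nonneg, le_rfl⟩
  -- the gap `U > 0`, continuous, `U 0 = -x`
  set U : ℝ≥0 → ℝ := fun t ↦ -realFlow w x t with hU
  have hUpos : ∀ t, 0 < U t := fun t ↦ neg_pos.2 (realFlow_neg hw hxw (halive t))
  have hUc : Continuous U := by
    have : U = fun t ↦ -realFlowStop w x t :=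
      funext fun t ↦ by simp only [hU, realFlowStop_of_lt (halive t)]
    rw [this]
    exact (continuous_realFlowStop_of_lt hw hxw).neg
  have hU0 : U 0 = -x := by simp only [hU, realFlow_zero hw hxw', hw0, sub_zero]
  have hz0 : z 0 = 0 := by
    have h1 := hwzo 0
    rw [hw0, ho 0] at h1
    simp only [NNReal.coe_zero, intervalIntegral.integral_same, mul_zero, add_zero] at h1
    exact h1.symm
  have key : ∀ t : ℝ≥0, IntervalIntegrable (fun u : ℝ ↦ (U u.toNNReal)⁻¹) volume 0 t ∧
      U t - z t = -x + 2 * ∫ u in (0:ℝ)..(t:ℝ), ((U u.toNNReal)⁻¹ - (z u.toNNReal)⁻¹) :=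
    fun t ↦ neg_realFlow_sub_eq_of_neg hw hw0 hint ho hwzo hx (halive t)
  -- Step A: `U − z > 0` everywhere ("`g_t(x) ≤ O_t`")
  have hA : ∀ t, 0 < U t - z t := by
    intro t
    refine sub_pos_of_gap_identity (b := t) hx hUc hz (by rw [hU0, hz0]; ring)
      (fun s _ _ hsz ↦ ?_) (key t).1 (hint t) (fun s _ ↦ (key s).2) t le_rfl
    rw [← hsz]; exact hUpos s
  -- the gap equation `U_t = −x + w_t + 2 ∫₀ᵗ du/U_u`
  have hUeq : ∀ t : ℝ≥0, U t = -x + w t + 2 * ∫ u in (0:ℝ)..(t:ℝ), (U u.toNNReal)⁻¹ := by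
    intro t
    have h1 := realFlow_eq_sub_add_integral hw hxw' (halive t)
    have h2 : ∫ u in (0:ℝ)..(t:ℝ), 2 / realFlow w x u.toNNReal =
        -2 * ∫ u in (0:ℝ)..(t:ℝ), (U u.toNNReal)⁻¹ := by
      rw [← intervalIntegral.integral_const_mul]
      refine intervalIntegral.integral_congr fun u _ ↦ ?_
      simp only [hU, inv_neg, div_eq_mul_inv]
      ring
    show -realFlow w x t = -x + w t + 2 * ∫ u in (0:ℝ)..(t:ℝ), (U u.toNNReal)⁻¹
    rw [h1, h2]
    ring
  -- the first zero `σ > 0` of `v`; `v > 0` before `σ`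
  set Sv : Set ℝ≥0 := {t | v t = 0} with hSv
  have hSvc : IsClosed Sv := isClosed_eq hv continuous_const
  obtain ⟨t₀, ht₀⟩ := hvzero
  set σ := sInf Sv with hσ
  have hvσ : v σ = 0 := hSvc.csInf_mem ⟨t₀, ht₀⟩ (OrderBot.bddBelow _)
  have hσ0 : 0 < σ := by
    rcases eq_zero_or_pos σ with h | h
    · exfalso; rw [h, hv0] at hvσ; linarith
    · exact h
  have hvpos : ∀ t, t < σ → 0 < v t := by
    intro t ht
    by_contra hle
    push Not at hle
    have hmem : (0:ℝ) ∈ Icc (v t) (v 0) := ⟨hle, by rw [hv0]; linarith⟩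
    obtain ⟨s, hs, hs0⟩ := intermediate_value_Icc' (bot_le : (0:ℝ≥0) ≤ t) hv.continuousOn hmem
    have : σ ≤ s := csInf_le (OrderBot.bddBelow _) hs0
    exact absurd (hs.2.trans_lt ht) (not_lt.2 this)
  -- `D = v − U`, `D 0 = 0`, `D σ < 0`; the last time `ts < σ` with `D ≥ 0`
  set D : ℝ≥0 → ℝ := fun t ↦ v t - U t with hD
  have hDc : Continuous D := hv.sub hUc
  have hD0 : D 0 = 0 := by simp only [hD, hv0, hU0, sub_self]
  have hDσ : D σ < 0 := by simp only [hD, hvσ, zero_sub, neg_lt_zero]; exact hUpos σ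
  set S : Set ℝ≥0 := {t | t ≤ σ ∧ 0 ≤ D t} with hS
  have hSc : IsClosed S :=
    (isClosed_le continuous_id continuous_const).inter (isClosed_le continuous_const hDc)
  have h0S : (0:ℝ≥0) ∈ S := ⟨hσ0.le, hD0.ge⟩
  have hSbdd : BddAbove S := ⟨σ, fun t ht ↦ ht.1⟩
  set ts := sSup S with hts
  have htsS : ts ∈ S := hSc.csSup_mem ⟨0, h0S⟩ hSbdd
  have hts_le : ts ≤ σ := htsS.1
  have hts_lt : ts < σ := lt_of_le_of_ne hts_le fun h ↦ by
    have := htsS.2; rw [h] at this; linarith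
  have hDneg : ∀ t, ts < t → t ≤ σ → D t < 0 := by
    intro t h1 h2
    by_contra hge
    push Not at hge
    exact absurd h1 (not_lt.2 (le_csSup hSbdd ⟨h2, hge⟩))
  have hDts : D ts = 0 := by
    refine le_antisymm ?_ htsS.2
    have hcl : IsClosed {t : ℝ≥0 | D t ≤ 0} := isClosed_le hDc continuous_const
    have hsub : Ioo ts σ ⊆ {t | D t ≤ 0} := fun t ht ↦ (hDneg t ht.1 ht.2.le).le
    have hcl' := closure_minimal hsub hcl
    rw [closure_Ioo hts_lt.ne] at hcl'
    exact hcl' ⟨le_rfl, hts_le⟩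
  -- a time `t ∈ (ts, σ)`
  obtain ⟨t, hts_t, ht_σ⟩ := exists_between hts_lt
  have hDt : D t < 0 := hDneg t hts_t ht_σ.le
  have hts_t' : (ts : ℝ) < t := by exact_mod_cast hts_t
  -- the three increments over `[ts, t]`
  set Iv : ℝ := ∫ u in (ts:ℝ)..(t:ℝ), (v u.toNNReal)⁻¹ with hIv
  set Iz : ℝ := ∫ u in (ts:ℝ)..(t:ℝ), (z u.toNNReal)⁻¹ with hIz
  set IU : ℝ := ∫ u in (ts:ℝ)..(t:ℝ), (U u.toNNReal)⁻¹ with hIU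
  have hUint : ∀ s : ℝ≥0, IntervalIntegrable (fun u : ℝ ↦ (U u.toNNReal)⁻¹) volume 0 s :=
    fun s ↦ (key s).1
  have hsplit : ∀ {F : ℝ → ℝ}, (∀ s : ℝ≥0, IntervalIntegrable F volume 0 s) →
      ∫ u in (0:ℝ)..(t:ℝ), F u = (∫ u in (0:ℝ)..(ts:ℝ), F u) + ∫ u in (ts:ℝ)..(t:ℝ), F u := by
    intro F hF
    have h1 : IntervalIntegrable F volume (0:ℝ) ts := by simpa using hmono hF 0 ts bot_le
    exact (intervalIntegral.integral_add_adjacent_intervals h1 (hmono hF ts t hts_t.le)).symm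
  have hDt_eq : D t = (ρ + 2) * (Iv - IU) + ρ * (IU - Iz) := by
    have e1 : D t - D ts = (ρ + 2) * Iv - ρ * Iz - 2 * IU := by
      simp only [hD]
      rw [hveq t, hveq ts, hUeq t, hUeq ts, hweq t, hweq ts, hsplit hvint, hsplit hint,
        hsplit hUint]
      ring
    rw [hDts, sub_zero] at e1
    rw [e1]
    ring
  -- `Iv − IU > 0`: on `(ts, t]` one has `0 < v < U`
  have h1 : 0 < Iv - IU := by
    rw [hIv, hIU, ← intervalIntegral.integral_sub (hmono hvint ts t hts_t.le) (hmono hUint ts t hts_t.le)]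
    refine intervalIntegral.intervalIntegral_pos_of_pos_on
      ((hmono hvint ts t hts_t.le).sub (hmono hUint ts t hts_t.le)) (fun u hu ↦ ?_) hts_t'
    have hu0 : 0 ≤ u := ts.coe_nonneg.trans hu.1.le
    have hu1 : ts < u.toNNReal := by
      rw [← NNReal.coe_lt_coe, Real.coe_toNNReal _ hu0]; exact hu.1
    have hu2 : u.toNNReal < σ := by
      refine lt_trans ?_ ht_σ
      rw [← NNReal.coe_lt_coe, Real.coe_toNNReal _ hu0]; exact hu.2
    have hvu : 0 < v u.toNNReal := hvpos _ hu2
    have hlt : v u.toNNReal < U u.toNNReal := by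
      have := hDneg _ hu1 hu2.le
      simp only [hD] at this
      linarith
    exact sub_pos.2 ((inv_lt_inv₀ (hUpos _) hvu).2 hlt)
  -- `IU − Iz ≤ 0`: `U ≥ z > 0` at a.e. time
  have h2 : IU - Iz ≤ 0 := by
    rw [hIU, hIz, ← intervalIntegral.integral_sub (hmono hUint ts t hts_t.le) (hmono hint ts t hts_t.le)]
    have hae : ∀ᵐ u ∂(volume.restrict (Ioc (ts:ℝ) t)),
        (U u.toNNReal)⁻¹ - (z u.toNNReal)⁻¹ ≤ 0 := by
      have hsub : Ioc (ts:ℝ) t ⊆ Ioi 0 := Ioc_subset_Ioi_self.trans (Ioi_subset_Ioi ts.coe_nonneg)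
      filter_upwards [ae_restrict_of_ae_restrict_of_subset hsub hzae] with u hu
      have hle : z u.toNNReal ≤ U u.toNNReal := by have := hA u.toNNReal; linarith
      exact sub_nonpos.2 (inv_anti₀ hu hle)
    have hIcc : volume.restrict (Ioc (ts:ℝ) t) = volume.restrict (Icc (ts:ℝ) t) :=
      Measure.restrict_congr_set Ioc_ae_eq_Icc
    have := intervalIntegral.integral_nonneg_of_ae_restrict hts_t'.le
      (f := fun u ↦ -((U u.toNNReal)⁻¹ - (z u.toNNReal)⁻¹)) (μ := volume)
      (by rw [← hIcc]; filter_upwards [hae] with u hu; simpa using hu)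
    rw [intervalIntegral.integral_neg] at this
    linarith
  -- contradiction: `D t > 0`
  have : 0 < D t := by
    rw [hDt_eq]
    have h3 : 0 ≤ ρ * (IU - Iz) := mul_nonneg_of_nonpos_of_nonpos hρ.le h2
    have h4 : 0 < (ρ + 2) * (Iv - IU) := mul_pos hρ2 h1
    linarith
  linarith

end Loewner

/-! ### Discharge of the named fact -/

open Literature.Probability.Process (preWienerMeasure brownian continuous_brownian brownian_zero)
open Literature.Analysis.FunctionSpaces (IsBesselProcess exists_isBesselProcess)

/-- **[LSW] Lemma 8.3 (2)–(3) hold** (discharge of the named fact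
`SLEKappaRho.swallowingTime_ofReal`): for `0 < κ ≤ 4`, `ρ > −2`, `ρ₀ = −2 + κ/2` and an
SLE(κ, ρ) driving pair `(O, W)`, almost surely: no `x > 0` is ever swallowed
(`SLEKappaRho.swallowingTime_ofReal_pos_holds`); if `ρ ≥ ρ₀` no `x < 0` is ever swallowed (the
Bessel dimension `d = 1 + 2(ρ + 2)/κ` is `≥ 2`, so `Z = W − O = √κ X > 0` at all positive times,
`IsBesselProcess.ae_forall_pos_of_two_le_zero_holds`, and
`Loewner.swallowingTime_eq_top_of_neg_of_forall_pos` applies); if `ρ < ρ₀` every `x < 0` is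
swallowed in finite time (`d < 2`: for each level `−(n + 1)` the comparison path
`v = √κ · BES^d((n + 1)/√κ)` driven by `B` satisfies `v_t = (n + 1) + √κ B_t + (ρ + 2) ∫₀ᵗ du/v_u`
(`IsBesselProcess.ae_eq_add_brownian_add_integral_holds`) and vanishes somewhere
(`IsBesselProcess.ae_exists_eq_zero_of_lt_two`), `Z > 0` at a.e. time
(`IsBesselProcess.ae_pos_of_ae_restrict_Ioi_holds`), so
`Loewner.swallowingTime_lt_top_of_bessel_comparison` gives `T_{−(n+1)} < ⊤`, and all `x < 0`
follow by monotonicity, `Loewner.swallowingTime_mono_left` — [LSW]: "by scaling"). The path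
identities `W = √κ B + ρ ∫ du/Z`, `∫₀ᵗ du/Z_u < ∞` and the continuity of the paths are
`SLEKappaRho.integral_inv_eq_holds`, `SLEKappaRho.ae_snd_eq_of`, `IsSLEKappaRhoPair.ae_continuous`.
[cite: LawlerSchrammWerner2003Restriction, Lemma 8.3 (2)–(3) (p. 36)] -/
theorem SLEKappaRho.swallowingTime_ofReal_holds : SLEKappaRho.swallowingTime_ofReal := by
  intro κ ρ O W hκ hκ4 hρ hOW
  have hpos := SLEKappaRho.swallowingTime_ofReal_pos_holds hκ hκ4 hρ hOW
  have h1 := SLEKappaRho.integral_inv_eq_holds hκ hρ hOW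
  have h2 := SLEKappaRho.ae_snd_eq_of SLEKappaRho.integral_inv_eq_holds hκ hρ hOW
  have h3 := hOW.ae_continuous SLEKappaRho.integral_inv_eq_holds hκ hρ
  have hW0 : ∀ ω, W 0 ω = 0 := hOW.snd_zero
  obtain ⟨X, hX, hO, hW⟩ := hOW
  have hκ0 : (0:ℝ) < κ := by exact_mod_cast hκ
  have hκ4' : (κ:ℝ) ≤ 4 := by exact_mod_cast hκ4
  have hsκ : 0 < Real.sqrt κ := Real.sqrt_pos.2 hκ0
  have hρ2 : 0 < ρ + 2 := by linarith
  set d := sleKappaRhoDim κ ρ with hd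
  have hd' : (d - 1) / 2 = (ρ + 2) / κ := by
    simp only [hd, sleKappaRhoDim]
    field_simp
    ring
  have hd1 : 1 < d := by
    have : 0 < (ρ + 2) / (κ:ℝ) := div_pos hρ2 hκ0
    linarith
  -- `Z = W − O = √κ X` pointwise
  have hZ : ∀ t ω, W t ω - O t ω = Real.sqrt κ * X t ω := fun t ω ↦ by rw [hW t ω]; ring
  -- `X > 0` at a.e. positive time (`d > 1`)
  have h4 := IsBesselProcess.ae_pos_of_ae_restrict_Ioi_holds hd1 le_rfl hX
  -- for `d ≥ 2`: `X > 0` at all positive times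
  have h5 : ∀ᵐ ω ∂preWienerMeasure, 2 ≤ d → ∀ t : ℝ≥0, 0 < t → 0 < X t ω := by
    by_cases hd2 : 2 ≤ d
    · filter_upwards [IsBesselProcess.ae_forall_pos_of_two_le_zero_holds hd2 hX] with ω hω _
        using hω
    · exact ae_of_all _ fun ω h ↦ absurd h hd2
  -- for `d < 2`: the comparison Bessel paths from the levels `n + 1`
  have h6 : ∀ᵐ ω ∂preWienerMeasure, d < 2 → ∀ n : ℕ, ∃ v : ℝ≥0 → ℝ, Continuous v ∧
      v 0 = (n : ℝ) + 1 ∧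
      (∀ t : ℝ≥0, IntervalIntegrable (fun u : ℝ ↦ (v u.toNNReal)⁻¹) volume 0 t) ∧
      (∀ t : ℝ≥0, v t = (n : ℝ) + 1 + Real.sqrt κ * brownian t ω +
        (ρ + 2) * ∫ u in (0:ℝ)..(t:ℝ), (v u.toNNReal)⁻¹) ∧ ∃ t, v t = 0 := by
    by_cases hd2 : d < 2
    · have hcoef : Real.sqrt κ * ((d - 1) / 2) = (ρ + 2) * (Real.sqrt κ)⁻¹ := by
        rw [hd', eq_comm]
        field_simp
        rw [Real.sq_sqrt hκ0.le]
      have key : ∀ n : ℕ, ∀ᵐ ω ∂preWienerMeasure, ∃ v : ℝ≥0 → ℝ, Continuous v ∧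
          v 0 = (n : ℝ) + 1 ∧
          (∀ t : ℝ≥0, IntervalIntegrable (fun u : ℝ ↦ (v u.toNNReal)⁻¹) volume 0 t) ∧
          (∀ t : ℝ≥0, v t = (n : ℝ) + 1 + Real.sqrt κ * brownian t ω +
            (ρ + 2) * ∫ u in (0:ℝ)..(t:ℝ), (v u.toNNReal)⁻¹) ∧ ∃ t, v t = 0 := by
        intro n
        set x₀ : ℝ := ((n : ℝ) + 1) / Real.sqrt κ with hx₀
        have hx₀pos : 0 < x₀ := by positivity
        have hx₀κ : Real.sqrt κ * x₀ = (n : ℝ) + 1 := by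
          rw [hx₀]; field_simp
        obtain ⟨R, hR⟩ := exists_isBesselProcess d x₀
        filter_upwards [IsBesselProcess.ae_eq_add_brownian_add_integral_holds hd1 hx₀pos.le hR,
          IsBesselProcess.ae_exists_eq_zero_of_lt_two hd1 hd2 hx₀pos hR, hR.ae_continuous]
          with ω hSDE hzero hc
        have hIint : ∀ t : ℝ≥0,
            IntervalIntegrable (fun u : ℝ ↦ (R u.toNNReal ω)⁻¹) volume 0 t := fun t ↦
          (intervalIntegrable_iff_integrableOn_Icc_of_le t.coe_nonneg).2 (hSDE t).1
        have hinv : ∀ t : ℝ≥0, (∫ u in (0:ℝ)..(t:ℝ), (Real.sqrt κ * R u.toNNReal ω)⁻¹) =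
            (Real.sqrt κ)⁻¹ * ∫ u in (0:ℝ)..(t:ℝ), (R u.toNNReal ω)⁻¹ := by
          intro t
          rw [← intervalIntegral.integral_const_mul]
          refine intervalIntegral.integral_congr fun u _ ↦ ?_
          simp only [mul_inv]
        refine ⟨fun t ↦ Real.sqrt κ * R t ω, continuous_const.mul hc, ?_, ?_, ?_, ?_⟩
        · show Real.sqrt κ * R 0 ω = (n : ℝ) + 1
          rw [hR.apply_zero ω, abs_of_pos hx₀pos, hx₀κ]
        · intro t
          have := (hIint t).const_mul (Real.sqrt κ)⁻¹
          refine this.congr fun u _ ↦ ?_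
          simp only [mul_inv]
        · intro t
          show Real.sqrt κ * R t ω = (n : ℝ) + 1 + Real.sqrt κ * brownian t ω +
            (ρ + 2) * ∫ u in (0:ℝ)..(t:ℝ), (Real.sqrt κ * R u.toNNReal ω)⁻¹
          rw [hinv t, (hSDE t).2, ← hx₀κ]
          have : Real.sqrt κ * ((d - 1) / 2 * ∫ u in (0:ℝ)..(t:ℝ), (R u.toNNReal ω)⁻¹) =
              (ρ + 2) * ((Real.sqrt κ)⁻¹ * ∫ u in (0:ℝ)..(t:ℝ), (R u.toNNReal ω)⁻¹) := by
            rw [← mul_assoc, hcoef, mul_assoc]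
          rw [mul_add, mul_add, this]
        · obtain ⟨t, ht⟩ := hzero
          exact ⟨t, by simp only [ht, mul_zero]⟩
      filter_upwards [ae_all_iff.2 key] with ω hω _ using hω
    · exact ae_of_all _ fun ω h ↦ absurd h hd2
  filter_upwards [hpos, h1, h2, h3, h4, h5, h6] with ω hposω hI hWeq hc hae hposX hcmp x
  -- pathwise data common to the two negative-axis clauses
  have hWc : Continuous fun t ↦ W t ω := hc.1
  have hZc : Continuous fun t ↦ W t ω - O t ω := hc.1.sub hc.2
  have hint' : ∀ t : ℝ≥0,
      IntervalIntegrable (fun u : ℝ ↦ (W u.toNNReal ω - O u.toNNReal ω)⁻¹) volume 0 t :=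
    fun t ↦ (hI t).1
  have ho' : ∀ t : ℝ≥0,
      O t ω = -2 * ∫ u in (0:ℝ)..(t:ℝ), (W u.toNNReal ω - O u.toNNReal ω)⁻¹ := by
    intro t
    rw [hO t ω]
    congr 1
    exact intervalIntegral.integral_congr fun u _ ↦ by simp only [hZ]
  have hwzo' : ∀ t, W t ω = (W t ω - O t ω) + O t ω := fun t ↦ by ring
  have hxW : ∀ {y : ℝ}, y < 0 → y < (fun t ↦ W t ω) 0 := fun hy ↦ by
    show _ < W 0 ω
    rwa [hW0 ω]
  refine ⟨hposω x, fun hx hρ₀ ↦ ?_, fun hx hρ₀ ↦ ?_⟩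
  · -- (2): `ρ ≥ ρ₀`, i.e. `d ≥ 2`: `Z > 0` at all positive times
    have hd2 : 2 ≤ d := by
      have : 1 ≤ 2 * (ρ + 2) / (κ:ℝ) := by
        rw [le_div_iff₀ hκ0]
        linarith
      have hdd : d = 1 + 2 * (ρ + 2) / κ := by simp only [hd, sleKappaRhoDim]
      linarith
    have hzpos : ∀ t : ℝ≥0, 0 < t → 0 < W t ω - O t ω := fun t ht ↦ by
      rw [hZ]; exact mul_pos hsκ (hposX hd2 t ht)
    exact Loewner.swallowingTime_eq_top_of_neg_of_forall_pos (z := fun t ↦ W t ω - O t ω)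
      (o := fun t ↦ O t ω) hWc (hW0 ω) hZc hzpos hint' ho' hwzo' hx
  · -- (3): `ρ < ρ₀`, i.e. `d < 2` (and `ρ < 0` as `κ ≤ 4`)
    have hd2 : d < 2 := by
      have : 2 * (ρ + 2) / (κ:ℝ) < 1 := by
        rw [div_lt_one hκ0]
        linarith
      have hdd : d = 1 + 2 * (ρ + 2) / κ := by simp only [hd, sleKappaRhoDim]
      linarith
    have hρneg : ρ < 0 := by linarith
    obtain ⟨n, hn⟩ := exists_nat_gt (-x)
    obtain ⟨v, hvc, hv0, hvint, hveq, hvzero⟩ := hcmp hd2 n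
    have hzae : ∀ᵐ s ∂(volume.restrict (Ioi (0:ℝ))), 0 < W s.toNNReal ω - O s.toNNReal ω := by
      filter_upwards [hae] with s hs
      rw [hZ]
      exact mul_pos hsκ hs
    have hlev : -((n : ℝ) + 1) < 0 := by linarith
    have hT : Loewner.swallowingTime (fun t ↦ W t ω) (-((n : ℝ) + 1) : ℝ) < ⊤ :=
      Loewner.swallowingTime_lt_top_of_bessel_comparison (z := fun t ↦ W t ω - O t ω)
        (o := fun t ↦ O t ω) (β := fun t ↦ brownian t ω) (v := v) hWc (hW0 ω) hZc hzae
        hint' ho' hwzo' hρneg hρ2 (fun t ↦ hWeq t) hlev hvc (by rw [hv0]; ring) hvint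
        (fun t ↦ by rw [hveq t]; ring) hvzero
    refine lt_of_le_of_lt ?_ hT
    exact Loewner.swallowingTime_mono_left hWc (hxW hx) (by linarith)

end Literature.Probability.RandomPlanarGeometry

end
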